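import Mathlib
import Literature.NumberTheory.LFunctions.Zhang2022.Section8Eq81aResidue
import Literature.NumberTheory.LFunctions.Zhang2022.Section8Eq81bEdge
import Literature.NumberTheory.LFunctions.Zhang2022.Section8AdmissibleRectangle
import Literature.NumberTheory.LFunctions.Zhang2022.Section13U007a
import Literature.NumberTheory.LFunctions.Zhang2022.ClosedFormsPartOne
import HarnessLib

/-!
# Zhang (2022) §13 p. 75, "Combining (2.34), … we can verify that 𝓔 = o(𝔓)": the (2.34)/residue
# conversion of a sum over the zeros `ρ ∈ 𝔷(ψ)` into the segment integrals over `𝒥(±α)`, for a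
# GENERIC holomorphic co-factor — kernel-checked infrastructure for (13.11)

Topic `Literature/NumberTheory/LFunctions/Zhang2022` (Landau–Siegel audit tree; verdict-neutral).
Y. Zhang, *Discrete mean estimates and the Landau–Siegel zero*, arXiv:2211.02515v1 (2022)
[Zhang2022LandauSiegel], §13 p. 75 (tex L3806–L3817) — an unrefereed manuscript under adjudication;
nothing here asserts or denies its Theorems 1–2. Lane ZHANG-L (WP14), GAP row G-L3t6-3 ("(13.11):
`𝓔 = o(𝔓)` — the verification is not carried out in print"). The printed instruction is

> "Combining (2.34), Cauchy's inequality, Proposition 7.1, Lemma 5.9, 6.1 and 3.3, we can verify that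
> `𝓔 = o(𝔓)` (13.11). For example, by (2.34),
> `Σ_{ψ∈Ψ₁}Σ_{ρ∈𝔷(ψ)} |L(ρ+β₁,ψ)/L′(ρ,ψ)||L(ρ+β₂,ψ)|²ω(ρ)
>   = −(1/2π)Σ_{ψ∈Ψ₁}(∫_{𝒥(α)} − ∫_{𝒥(−α)}) [M(s+β₁,ψ)/M(s,ψ)]L(s+β₂,ψ)L(1−s−β₂,ψ̄)ω(s)ds + O(ε)`".

Every term of `𝓔` (display after (13.10)) is a sum over `(ψ, ρ)` of `|L(ρ+β₁,ψ)/L′(ρ,ψ)|·G(ρ)·ω(ρ)`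
with `G ≥ 0`; after Cauchy's inequality each factor is such a sum with `G(ρ) = H(ρ)` for some
function `H` HOLOMORPHIC near the critical segment (e.g. `H(s) = L(s+β₂,ψ)L(1−s−β₂,ψ̄)`,
`B(s,ψ)B̄(1−s,ψ̄)`, `N(s+β₃,ψ)N̄(1−s−β₃,ψ̄)`, …). This file proves the conversion ONCE for an arbitrary
such `H` — the §8 proof of (8.1) (tree theorems `Section8aStatements.eq81a_at` (residue theorem on an
admissible rectangle), `eq81b_of_prop22` (negligible edges), `admRect_of_prop22_at`,
`rectIntegral_sub_segInt_eq`, `clearance_of_prop22i`, `Skeleton.lemma59_restricted_of_prop22`,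
`Typed.Section13.Yroot_shift_eq_mul`) re-run with the integrand
`F_H(s) = [M(s+β₁,ψ)/M(s,ψ)]·H(s)·ω(s)` in place of `𝒞̃(s,ψ)A(𝐚₁;s)A(𝐚₂;1−s)ω(s)`:

* `zeroSum_eq_rectIntegral_at` — the residue theorem: for an admissible rectangle `ℜ` of `ψ`,
  `Σ_{ρ∈𝔷(ψ)} [M(ρ+β₁,ψ)/M′(ρ,ψ)]·H(ρ)·ω(ρ) = (1/2πi)∮_{∂ℜ} F_H` (poles = the zeros of `L(s,ψ)` in
  the collar, simple by Prop. 2.2 (ii); residue of `F_H` at `ρ` = `M(ρ+β₁)H(ρ)ω(ρ)/M′(ρ)`);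
* `norm_convIntegrand_le` — on the pieces of `∂ℜ` off `𝒥(±α)` (`|σ−½| ≤ α`, `𝓛₁−1 ≤ |t−2πt₀| ≤ 𝓛₁+¼`):
  `‖F_H(s)‖ ≤ e³(|C₅.₉|+1)·‖H‖_∞·e^{−𝓛¹⁰/8}` (`|Y(s+β₁)/Y(s)| ≤ e`, Lemma 5.9 `|L(s+β₁)/L(s)| ≤ C₅.₉𝓛⁹`,
  `|ω(s)| ≤ e^{2−𝓛¹⁰/4}`, `𝓛⁹e^{−𝓛¹⁰/4} ≤ e^{−𝓛¹⁰/8}`);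
* `continuousOn_convIntegrand_vertical` — continuity of `F_H` along `σ = ½ ± α` (no zero of `L` there);
* `zeroSum_conversion_of_prop22` — **the conversion**: for `c′ ≥ 0` with `Skeleton.Prop22 c′`, there is
  `K` such that for all large `D`, every `ψ ∈ Ψ₁`, every `H` holomorphic on the upper half-plane with
  `‖H(s)‖ ≤ H_max` on `|σ−½| ≤ α`, `|t−2πt₀| ≤ 𝓛₁+1`:
  `‖Σ_{ρ∈𝔷(ψ)} [M(ρ+β₁)/M′(ρ)]H(ρ)ω(ρ) − (segInt_α F_H − segInt_{−α} F_H)‖ ≤ K·H_max·e^{−𝓛¹⁰/8}`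
  (`segInt_z F = (1/2π)∫_{−𝓛₁}^{𝓛₁} F(z+s₀+iv)dv = (1/2πi)∫_{𝒥(z)} F ds`, the tree's `Lemma81.segInt`);
* `zeroSum_conversion_eq234_of_prop22` — the same with the positive weight of (2.34)
  (`|L(ρ+β₁,ψ)/L′(ρ,ψ)| = −iM(ρ+β₁,ψ)/M′(ρ,ψ)`, tree theorem `Section2.eq234_of_prop22`):
  `‖Σ_{ρ∈𝔷(ψ)} |L(ρ+β₁)/L′(ρ)|·H(ρ)ω(ρ) + i(segInt_α F_H − segInt_{−α} F_H)‖ ≤ K·H_max·e^{−𝓛¹⁰/8}`;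
* `zeroSum_conversion_eventually` — for every sufficiently large `c′` (Prop. 2.2 is a tree theorem
  for large `c′`: `Skeleton.prop22_eventually`), NO hypothesis.

Theorems only: no new definition, no new fact, axioms standard. WHAT THIS IS NOT: any of the
mean-value estimates "via Lemma 6.1 and 3.3" (`U007b`-type), Cauchy's inequality step, or (13.11).

## References

* Y. Zhang, arXiv:2211.02515v1 (2022), §13 p. 75, tex L3806–L3817; §8 (8.1) p. 42, tex L2194–L2206;
  §2 (2.34) p. 12; §5 Lemma 5.9. [cite: Zhang2022LandauSiegel, §13 p.75]
* J. B. Conway, *Functions of One Complex Variable I*, 2nd ed. (1978), Ch. V Thm. 2.2 (residue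
  theorem; the tree's `RectangleResidueSimplePoles`). [cite: Conway1978, Ch. V Thm. 2.2]
-/

noncomputable section

open Complex Real Set Filter Topology MeasureTheory intervalIntegral

namespace Literature.NumberTheory.LFunctions.Zhang2022.Typed.Section13

open Skeleton GammaFactor Section8aStatements
open Literature.Analysis.Complex (rectBoundaryIntegral rectBoundaryIntegral_eq_sum_of_simplePoles)

/-! ## Small bookkeeping (private) -/

/-- Clamping `v` into `[lo, hi]` (coordinatewise projection onto the closed rectangle; copy of the
private lemma of `Section8Eq81aResidue`). [folklore] -/
private theorem clamp_spec' {lo hi v δ : ℝ} (hlh : lo ≤ hi) (hδ : 0 < δ) (h1 : lo - δ < v)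
    (h2 : v < hi + δ) :
    lo ≤ max lo (min hi v) ∧ max lo (min hi v) ≤ hi ∧ |max lo (min hi v) - v| < δ ∧
      (v ≤ lo → max lo (min hi v) = lo) ∧ (hi ≤ v → max lo (min hi v) = hi) := by
  refine ⟨le_max_left _ _, max_le hlh (min_le_left _ _), ?_, ?_, ?_⟩
  · rcases le_total hi v with h | h
    · rw [min_eq_left h, max_eq_right hlh, abs_lt]
      constructor <;> linarith
    · rw [min_eq_right h]
      rcases le_total lo v with h' | h'
      · rw [max_eq_right h', sub_self, abs_zero]; exact hδ
      · rw [max_eq_left h', abs_lt]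
        constructor <;> linarith
  · intro hv
    rw [min_eq_right (le_trans hv hlh), max_eq_left hv]
  · intro hv
    rw [min_eq_left hv, max_eq_right hlh]

/-- The threshold `D ≥ ⌈e^{L₀}⌉` gives `L₀ ≤ 𝓛`. [folklore] -/
private theorem threshold_le_ell {L₀ : ℝ} {D : ℕ} (hD : ⌈Real.exp L₀⌉₊ ≤ D) : L₀ ≤ ell D := by
  have h1 : Real.exp L₀ ≤ D := (Nat.le_ceil _).trans (by exact_mod_cast hD)
  have hD0 : (0 : ℝ) < D := (Real.exp_pos _).trans_le h1
  rw [ell, Real.le_log_iff_exp_le hD0]; exact h1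

/-- Parameters for `𝓛 ≥ 80`, `𝓛 ≥ 5π|c′| + 1`: `0 < α = π/𝓛⁹ ≤ 1/100`, `5c′α𝓛 < 1` (for `c′ ≥ 0`),
`|b₁| ≤ 1` and `0 ≤ b₁` (`b₁ = α(1 − 5c′α𝓛)`, `β₁ = ib₁`). [cite: Zhang2022LandauSiegel, §2 (2.10), (2.13)] -/
private theorem params13 {c' : ℝ} {D : ℕ} (hc' : 0 ≤ c') (h80 : 80 ≤ ell D)
    (hc : 5 * π * |c'| + 1 ≤ ell D) :
    0 < alpha D ∧ alpha D = π / ell D ^ 9 ∧ alpha D ≤ 1 / 100 ∧ 5 * c' * alpha D * ell D < 1 ∧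
      |b1 c' D| ≤ 1 ∧ 0 ≤ b1 c' D := by
  have hπ := Real.pi_pos
  have hL0 : 0 < ell D := by linarith
  have hL1 : 1 ≤ ell D := by linarith
  have hα : alpha D = π / ell D ^ 9 := by rw [alpha, bigP, Real.log_exp]
  have hL9pos : 0 < ell D ^ 9 := by positivity
  have hα0 : 0 < alpha D := by rw [hα]; positivity
  have hα100 : alpha D ≤ 1 / 100 := by
    have hL2 : ell D ^ 2 ≤ ell D ^ 9 := pow_le_pow_right₀ hL1 (by norm_num)
    rw [hα, div_le_iff₀ hL9pos]; nlinarith [Real.pi_lt_four]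
  have habs : |c'| = c' := abs_of_nonneg hc'
  rw [habs] at hc
  have hsmall : 5 * c' * alpha D * ell D < 1 := by
    have h8 : ell D ≤ ell D ^ 8 := le_self_pow₀ hL1 (by norm_num)
    have hkey : 5 * c' * π * ell D < ell D ^ 9 := by
      have h9 : ell D ^ 9 = ell D ^ 8 * ell D := by ring
      rw [h9]
      have : 5 * π * c' < ell D ^ 8 := by linarith
      nlinarith
    rw [hα]
    calc 5 * c' * (π / ell D ^ 9) * ell D = 5 * c' * π * ell D / ell D ^ 9 := by ring
      _ < 1 := by rw [div_lt_one hL9pos]; exact hkey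
  have hb1nn : 0 ≤ b1 c' D := by
    rw [b1]; exact mul_nonneg hα0.le (by linarith)
  have hb1le : b1 c' D ≤ alpha D := by
    rw [b1]
    have : 0 ≤ 5 * c' * alpha D * ell D := by positivity
    nlinarith
  refine ⟨hα0, hα, hα100, hsmall, ?_, hb1nn⟩
  rw [abs_of_nonneg hb1nn]; linarith

/-- The `t`-range of the contour pieces: `|t − 2π𝓛⁵¹⁹| ≤ 𝓛⁴⁰⁵ + 1`, `𝓛 ≥ 80` gives `t ≥ 8`, `t > 1`.
[cite: Zhang2022LandauSiegel, §2 (2.8)] -/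
private theorem trange13 {L t : ℝ} (hL : 80 ≤ L) (ht : |t - 2 * π * L ^ 519| ≤ L ^ 405 + 1) :
    8 ≤ t := by
  have hL1 : 1 ≤ L := by linarith
  have h405 : L ^ 405 + 1 ≤ L ^ 519 := by
    have h1 : (1 : ℝ) ≤ L ^ 405 := one_le_pow₀ hL1
    have h114 : 9 ≤ L ^ 114 := by
      have h : L ^ 1 ≤ L ^ 114 := pow_le_pow_right₀ hL1 (by norm_num)
      rw [pow_one] at h; linarith
    calc L ^ 405 + 1 ≤ L ^ 405 * 9 := by nlinarith
      _ ≤ L ^ 405 * L ^ 114 := by gcongr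
      _ = L ^ 519 := by rw [← pow_add]
  have h519 : L ≤ L ^ 519 := by
    calc L = L ^ 1 := (pow_one _).symm
      _ ≤ L ^ 519 := pow_le_pow_right₀ hL1 (by norm_num)
  obtain ⟨ht1, -⟩ := abs_le.mp ht
  have hπa : 3 * L ^ 519 ≤ π * L ^ 519 :=
    mul_le_mul_of_nonneg_right Real.pi_gt_three.le (by positivity)
  linarith

/-- The envelope `e·C·𝓛⁹·e^{2−𝓛¹⁰/4} ≤ e³·C·e^{−𝓛¹⁰/8}` for `𝓛 ≥ 2`, `C ≥ 0`. [folklore] -/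
private theorem envelope13 {L C : ℝ} (hL : 2 ≤ L) (hC : 0 ≤ C) :
    Real.exp 1 * C * L ^ 9 * Real.exp (2 - L ^ 10 / 4) ≤
      Real.exp 3 * C * Real.exp (-(L ^ 10 / 8)) := by
  have hL0 : 0 < L := by linarith
  -- `L⁹ ≤ e^{L¹⁰/8}`
  have h1 : L ^ 9 ≤ Real.exp (L ^ 10 / 8) := by
    have hLe : L ≤ Real.exp (L - 1) := by linarith [Real.add_one_le_exp (L - 1)]
    have h9 : L ^ 9 ≤ Real.exp (L - 1) ^ 9 := pow_le_pow_left₀ hL0.le hLe 9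
    rw [← Real.exp_nat_mul] at h9
    refine h9.trans (Real.exp_le_exp.mpr ?_)
    have h512 : (512 : ℝ) ≤ L ^ 9 := by
      calc (512 : ℝ) = 2 ^ 9 := by norm_num
        _ ≤ L ^ 9 := pow_le_pow_left₀ (by norm_num) hL 9
    have : L ^ 10 = L ^ 9 * L := by ring
    rw [this]; push_cast; nlinarith
  have h2 : Real.exp 1 * Real.exp (L ^ 10 / 8) * Real.exp (2 - L ^ 10 / 4) =
      Real.exp 3 * Real.exp (-(L ^ 10 / 8)) := by
    rw [← Real.exp_add, ← Real.exp_add, ← Real.exp_add]; congr 1; ring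
  calc Real.exp 1 * C * L ^ 9 * Real.exp (2 - L ^ 10 / 4)
      = C * (Real.exp 1 * L ^ 9 * Real.exp (2 - L ^ 10 / 4)) := by ring
    _ ≤ C * (Real.exp 1 * Real.exp (L ^ 10 / 8) * Real.exp (2 - L ^ 10 / 4)) := by
        gcongr
    _ = Real.exp 3 * C * Real.exp (-(L ^ 10 / 8)) := by rw [h2]; ring

section Setting

variable {D : ℕ} [NeZero D] (χ : DirichletCharacter ℂ D)

/-! ## A. The residue theorem for `F_H = [M(s+β₁)/M(s)]·H·ω` on an admissible rectangle -/

omit [NeZero D] in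
/-- The numerator `G(s) = M(s+β₁,ψ)·H(s)·ω(s)` is complex differentiable at every `s` with `Im s > 0`
when `Im β₁ ≥ 0` and `H` is holomorphic on the upper half-plane. [cite: Zhang2022LandauSiegel, §13 p.75] -/
theorem differentiableAt_convNumerator (c' : ℝ) (x : Chr D) (H : ℂ → ℂ)
    (hH : ∀ z : ℂ, 0 < z.im → DifferentiableAt ℂ H z) (hb1 : 0 ≤ (beta1 c' D).im)
    {s : ℂ} (hs : 0 < s.im) :
    DifferentiableAt ℂ (fun z => Mfun x.ψ (z + beta1 c' D) * H z * omegaW D z) s := by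
  have h1 := differentiableAt_Mfun_shift x (beta1 c' D) (s := s) (by rw [Complex.add_im]; linarith)
  have hω : DifferentiableAt ℂ (omegaW D) s := (differentiable_omegaW D) s
  exact (h1.mul (hH s hs)).mul hω

/-- **The residue theorem for the (2.34)-integrand**, at one character and one admissible rectangle
(the §13 analogue of the first equality of (8.1)): for `D ≥ 3`, `χ` primitive, `Im β₁ ≥ 0`, `0 < α`,
`c₀ > 0`, heights with `2πt₀ + 𝓛₁⁻ > c₀α` and `𝓛₁⁻ < 𝓛₁⁺`, a character `ψ` whose `Ω`-zeros of
`L(s,ψ)L(s,ψχ)` are simple (Prop. 2.2 (ii)), an admissible rectangle, and ANY `H` holomorphic on the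
upper half-plane:
`Σ_{ρ∈𝔷(ψ)} [M(ρ+β₁,ψ)/M′(ρ,ψ)]·H(ρ)·ω(ρ) = (1/2πi)∮_{∂ℜ} [M(s+β₁,ψ)/M(s,ψ)]·H(s)·ω(s) ds`.
[cite: Zhang2022LandauSiegel, §13 p.75 ("by (2.34) … = −(1/2π)Σ(∫_{𝒥(α)} − ∫_{𝒥(−α)}) …"); §8 (8.1) p.42] -/
theorem zeroSum_eq_rectIntegral_at (hD : 3 ≤ D) (hχ : χ.IsPrimitive) (c' : ℝ) (x : Chr D)
    (H : ℂ → ℂ) (hH : ∀ z : ℂ, 0 < z.im → DifferentiableAt ℂ H z)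
    (hb1 : 0 ≤ (beta1 c' D).im)
    {C c₀ Lm Lp : ℝ} (hc₀ : 0 < c₀) (hα : 0 < alpha D)
    (hLmpos : c₀ * alpha D < 2 * π * t0 D + Lm) (hLmLp : Lm < Lp)
    (h_ii : ∀ s ∈ prodZeroSetOmega χ x,
      deriv (fun w => x.ψ.LFunction w * (psiChi χ x).LFunction w) s ≠ 0)
    (hR : AdmRect D x C c₀ Lm Lp) :
    ∑ ρ ∈ finsetOf (zeroSet D x),
        Mfun x.ψ (ρ + beta1 c' D) / deriv (Mfun x.ψ) ρ * H ρ * omegaW D ρ =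
      rectIntegral D Lm Lp (fun s => Mfun x.ψ (s + beta1 c' D) / Mfun x.ψ s * H s * omegaW D s) := by
  -- adapted from Section8Eq81aResidue.eq81a_at (sz-d02): numerator 𝒞̃AAω ↦ M(s+β₁)Hω
  obtain ⟨hLp1, hLm1, hzeros, hdist⟩ := hR
  set T : ℝ := 2 * π * t0 D with hT
  set δ : ℝ := c₀ * alpha D / 2 with hδ
  have hδ0 : 0 < δ := by positivity
  -- the integrand as `G/M`
  set F : ℂ → ℂ := fun s => Mfun x.ψ (s + beta1 c' D) / Mfun x.ψ s * H s * omegaW D s with hF_def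
  set G : ℂ → ℂ := fun z => Mfun x.ψ (z + beta1 c' D) * H z * omegaW D z with hG_def
  have hFG : ∀ z, F z = G z / Mfun x.ψ z := by
    intro z
    simp only [hF_def, hG_def, div_eq_mul_inv]
    ring
  -- the finite set of poles
  have hfin : (zeroSet D x).Finite := zerosFinite_holds D x
  set S : Finset ℂ := finsetOf (zeroSet D x) with hS_def
  have hmemS : ∀ z, z ∈ S ↔ z ∈ zeroSet D x := fun z => mem_finsetOf hfin
  have hzeroR : ∀ {z}, z ∈ zeroSet D x → z ∈ rectR D Lm Lp := fun {z} hz => by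
    have h : z ∈ {ρ | x.ψ.LFunction ρ = 0 ∧ ρ ∈ rectR D Lm Lp} := by rw [hzeros]; exact hz
    exact h.2
  -- the open collar `U` around the closed rectangle
  set U : Set ℂ := Ioo (1 / 2 - alpha D - δ) (1 / 2 + alpha D + δ) ×ℂ Ioo (T + Lm - δ) (T + Lp + δ)
    with hU_def
  have hUo : IsOpen U := isOpen_Ioo.reProdIm isOpen_Ioo
  have hKU : Icc (1 / 2 - alpha D) (1 / 2 + alpha D) ×ℂ Icc (T + Lm) (T + Lp) ⊆ U := by
    intro z hz
    rw [mem_reProdIm] at hz ⊢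
    exact ⟨⟨by linarith [hz.1.1], by linarith [hz.1.2]⟩, ⟨by linarith [hz.2.1], by linarith [hz.2.2]⟩⟩
  have hUim : ∀ z ∈ U, 0 < z.im := fun z hz => by
    rw [mem_reProdIm] at hz; linarith [hz.2.1]
  -- a zero of `L(s,ψ)` in the collar lies in `𝔷(ψ)` (else it is within `c₀α` of `∂ℜ`)
  have hLzero : ∀ z ∈ U, x.ψ.LFunction z = 0 → z ∈ zeroSet D x := by
    intro z hz hL
    by_cases hrect : z ∈ rectR D Lm Lp
    · have h : z ∈ {ρ | x.ψ.LFunction ρ = 0 ∧ ρ ∈ rectR D Lm Lp} := ⟨hL, hrect⟩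
      rwa [hzeros] at h
    · exfalso
      rw [mem_reProdIm] at hz
      obtain ⟨⟨hzr1, hzr2⟩, ⟨hzi1, hzi2⟩⟩ := hz
      obtain ⟨hr1, hr2, hr3, hr4, hr5⟩ :=
        clamp_spec' (lo := 1 / 2 - alpha D) (hi := 1 / 2 + alpha D) (v := z.re) (by linarith) hδ0
          hzr1 hzr2
      obtain ⟨hi1, hi2, hi3, hi4, hi5⟩ :=
        clamp_spec' (lo := T + Lm) (hi := T + Lp) (v := z.im) (by linarith) hδ0 hzi1 hzi2
      set s : ℂ := ⟨max (1 / 2 - alpha D) (min (1 / 2 + alpha D) z.re),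
        max (T + Lm) (min (T + Lp) z.im)⟩ with hs_def
      have hsre : s.re = max (1 / 2 - alpha D) (min (1 / 2 + alpha D) z.re) := rfl
      have hsim : s.im = max (T + Lm) (min (T + Lp) z.im) := rfl
      have hsB : s ∈ onBoundaryR D Lm Lp := by
        refine ⟨⟨?_, ?_, ?_⟩, fun hsR => hrect ?_⟩
        · rw [hsre, abs_le]; constructor <;> linarith
        · rw [hsim]; exact hi1
        · rw [hsim]; exact hi2
        · obtain ⟨h1, h2, h3⟩ := hsR
          rw [hsre] at h1
          rw [hsim] at h2 h3
          refine ⟨?_, ?_, ?_⟩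
          · by_contra hc
            rw [not_lt] at hc
            rcases le_abs'.mp hc with h | h
            · rw [hr4 (by linarith)] at h1
              rw [abs_lt] at h1
              linarith [h1.1]
            · rw [hr5 (by linarith)] at h1
              rw [abs_lt] at h1
              linarith [h1.2]
          · by_contra hc
            rw [not_lt] at hc
            rw [hi4 hc] at h2
            exact lt_irrefl _ h2
          · by_contra hc
            rw [not_lt] at hc
            rw [hi5 hc] at h3
            exact lt_irrefl _ h3
      have hfar := hdist s hsB z hL
      have hnear : ‖s - z‖ < c₀ * alpha D := by
        have h := Complex.norm_le_abs_re_add_abs_im (s - z)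
        rw [Complex.sub_re, Complex.sub_im, hsre, hsim] at h
        have : c₀ * alpha D = δ + δ := by rw [hδ]; ring
        linarith
      linarith
  -- `M ≠ 0` on `U ∖ S`, and the integrand is holomorphic there
  have hMne : ∀ z ∈ U, z ∉ zeroSet D x → Mfun x.ψ z ≠ 0 := fun z hz hzS =>
    Mfun_ne_zero x (hUim z hz) (fun hL => hzS (hLzero z hz hL))
  have hUH : U ⊆ {s : ℂ | 0 < s.im} := fun z hz => hUim z hz
  have hMdiff : DifferentiableOn ℂ (Mfun x.ψ) U := (differentiableOn_Mfun x).mono hUH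
  have hFdiff : DifferentiableOn ℂ F (U \ ↑S) := by
    intro z hz
    obtain ⟨hzU, hzS⟩ := hz
    have hzS' : z ∉ zeroSet D x := fun h => hzS (Finset.mem_coe.mpr ((hmemS z).mpr h))
    have hGd := differentiableAt_convNumerator c' x H hH hb1 (hUim z hzU)
    have hMd : DifferentiableAt ℂ (Mfun x.ψ) z := hMdiff.differentiableAt (hUo.mem_nhds hzU)
    have h := hGd.div hMd (hMne z hzU hzS')
    have hFeq : F = fun z => G z / Mfun x.ψ z := funext hFG
    rw [hFeq]
    exact h.differentiableWithinAt
  -- the poles are simple, with the residues `M(ρ+β₁)H(ρ)ω(ρ)/M′(ρ)`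
  have hpoles : ∀ p ∈ S, ∃ φ : ℂ → ℂ, ∃ V ∈ 𝓝 p, DifferentiableOn ℂ φ V ∧
      φ p = (fun q => Mfun x.ψ (q + beta1 c' D) / deriv (Mfun x.ψ) q * H q * omegaW D q) p ∧
      ∀ z ∈ V, z ≠ p → F z = φ z / (z - p) := by
    intro p hpS
    have hp : p ∈ zeroSet D x := (hmemS p).mp hpS
    have hpR : p ∈ rectR D Lm Lp := hzeroR hp
    have hpU : p ∈ U := by
      obtain ⟨h1, h2, h3⟩ := hpR
      rw [mem_reProdIm]
      have h1' := abs_lt.mp h1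
      exact ⟨⟨by linarith [h1'.1], by linarith [h1'.2]⟩, ⟨by linarith, by linarith⟩⟩
    have hpim : 0 < p.im := hUim p hpU
    have hL0 : x.ψ.LFunction p = 0 := hp.2.2
    have hM0 : Mfun x.ψ p = 0 := by
      rw [show Mfun x.ψ p = Yroot x.ψ p * x.ψ.LFunction p from rfl, hL0, mul_zero]
    have hpS' : p ∈ prodZeroSetOmega χ x := mem_prodZeroSetOmega_of_mem_zeroSet χ hp
    have hL1 : deriv x.ψ.LFunction p ≠ 0 :=
      deriv_LFunction_ne_zero_of_deriv_LL_ne_zero χ hD hχ x hL0 (h_ii p hpS')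
    have hM1 : deriv (Mfun x.ψ) p ≠ 0 :=
      GammaFactor.deriv_M_ne_zero_of_simple_zero x.prim x.p_ne_one (Yroot_spec x.prim).1
        (Yroot_spec x.prim).2 hpim hL0 hL1
    -- `g = dslope M p`, holomorphic on `U`, `g(p) = M′(p) ≠ 0`
    set g : ℂ → ℂ := dslope (Mfun x.ψ) p with hg_def
    have hgdiff : DifferentiableOn ℂ g U :=
      (Complex.differentiableOn_dslope (hUo.mem_nhds hpU)).mpr hMdiff
    have hgp : g p = deriv (Mfun x.ψ) p := dslope_same _ _
    have hgne : {z | g z ≠ 0} ∈ 𝓝 p := by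
      have hc : ContinuousAt g p := (hgdiff.differentiableAt (hUo.mem_nhds hpU)).continuousAt
      exact hc.preimage_mem_nhds (isOpen_ne.mem_nhds (by rw [hgp]; exact hM1))
    set V : Set ℂ := U ∩ {z | g z ≠ 0} with hV_def
    have hV : V ∈ 𝓝 p := inter_mem (hUo.mem_nhds hpU) hgne
    refine ⟨fun z => G z * (g z)⁻¹, V, hV, ?_, ?_, ?_⟩
    · intro z hz
      obtain ⟨hzU, hgz⟩ := hz
      have hGd := differentiableAt_convNumerator c' x H hH hb1 (hUim z hzU)
      have hgd : DifferentiableAt ℂ g z := hgdiff.differentiableAt (hUo.mem_nhds hzU)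
      exact (hGd.mul (hgd.inv hgz)).differentiableWithinAt
    · simp only [hG_def, hgp, div_eq_mul_inv]
      ring
    · intro z hz hzp
      have hgz : g z = Mfun x.ψ z / (z - p) := by
        rw [hg_def, dslope_of_ne _ hzp, slope_def_field, hM0, sub_zero]
      show F z = G z * (g z)⁻¹ / (z - p)
      rw [hFG z, hgz]
      have hzp' : z - p ≠ 0 := sub_ne_zero.mpr hzp
      by_cases hMz : Mfun x.ψ z = 0
      · rw [hMz]; simp
      · field_simp
  -- the residue theorem
  have hab : (1 : ℝ) / 2 - alpha D < 1 / 2 + alpha D := by linarith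
  have hcd : T + Lm < T + Lp := by linarith
  have hSsub : (↑S : Set ℂ) ⊆ Ioo (1 / 2 - alpha D) (1 / 2 + alpha D) ×ℂ Ioo (T + Lm) (T + Lp) := by
    intro p hp
    have hp' : p ∈ zeroSet D x := (hmemS p).mp (Finset.mem_coe.mp hp)
    obtain ⟨h1, h2, h3⟩ := hzeroR hp'
    rw [mem_reProdIm]
    have h1' := abs_lt.mp h1
    exact ⟨⟨by linarith [h1'.1], by linarith [h1'.2]⟩, ⟨h2, h3⟩⟩
  have key := rectBoundaryIntegral_eq_sum_of_simplePoles hab hcd S F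
    (fun q => Mfun x.ψ (q + beta1 c' D) / deriv (Mfun x.ψ) q * H q * omegaW D q) U hUo hKU hSsub
    hFdiff hpoles
  have h2πI : (2 * π * I : ℂ) ≠ 0 := by simp [Real.pi_ne_zero, I_ne_zero]
  rw [rectIntegral, ← hT, key, ← mul_assoc, one_div_mul_cancel h2πI, one_mul]

/-! ## B. The integrand on the contour pieces off `𝒥(±α)`, and along `σ = ½ ± α` -/

omit [NeZero D] in
/-- **The size of `F_H = [M(s+β₁)/M(s)]·H·ω` on the pieces of `∂ℜ` off `𝒥(±α)`** — `|σ − ½| ≤ α`,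
`𝓛₁ − 1 ≤ |t − 2πt₀| ≤ 𝓛₁ + ¼` — given Lemma 5.9's bound at `s`: `‖F_H(s)‖ ≤ e³(|C₅.₉|+1)·H_max·e^{−𝓛¹⁰/8}`
(`M(s+β₁)/M(s) = [Y(s+β₁)/Y(s)]·[L(s+β₁)/L(s)]` with `|Y(s+β₁)/Y(s)| ≤ e` by
`Typed.Section13.Yroot_shift_eq_mul`, `|L(s+β₁)/L(s)| ≤ C₅.₉ log P = C₅.₉𝓛⁹`, `‖H(s)‖ ≤ H_max`,
`|ω(s)| ≤ e^{2−𝓛¹⁰/4}` by `norm_omegaW_le_exp`, and `e·𝓛⁹·e^{2−𝓛¹⁰/4} ≤ e³e^{−𝓛¹⁰/8}`).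
[cite: Zhang2022LandauSiegel, §13 p.75; §8 (8.1) p.42 ("a simple bound for `ω(s)`")] -/
theorem norm_convIntegrand_le (c' : ℝ) (x : Chr D) (H : ℂ → ℂ) {C₅₉ Hmax : ℝ}
    (hc' : 0 ≤ c') (h80 : 80 ≤ ell D) (hc : 5 * π * |c'| + 1 ≤ ell D) (hHmax : 0 ≤ Hmax) {s : ℂ}
    (hσ : |s.re - 1 / 2| ≤ alpha D)
    (ht1 : ell1 D - 1 ≤ |s.im - 2 * π * t0 D|) (ht2 : |s.im - 2 * π * t0 D| ≤ ell1 D + 1 / 4)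
    (h59 : ‖x.ψ.LFunction (s + beta1 c' D) / x.ψ.LFunction s‖ ≤ C₅₉ * Real.log (bigP D))
    (hHs : ‖H s‖ ≤ Hmax) :
    ‖Mfun x.ψ (s + beta1 c' D) / Mfun x.ψ s * H s * omegaW D s‖ ≤
      Real.exp 3 * (|C₅₉| + 1) * Hmax * Real.exp (-(ell D ^ 10 / 8)) := by
  have hL1 : 1 ≤ ell D := by linarith
  obtain ⟨hα0, hα, hα100, -, hb1, -⟩ := params13 hc' h80 hc
  obtain ⟨hβ1, -, -⟩ := beta_eq_b_mul_I c' D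
  obtain ⟨hs1, hs2⟩ := abs_le.mp hσ
  -- the point `s = σ' + it`
  set σ' : ℝ := s.re with hσ'
  set t : ℝ := s.im with ht
  have hs_eq : s = (σ' : ℂ) + t * I := (Complex.re_add_im s).symm
  have hσ'0 : 0 < σ' := by linarith
  have hσ'1 : σ' ≤ 1 := by linarith
  have ht8 : 8 ≤ t := by
    have ht' : |t - 2 * π * ell D ^ 519| ≤ ell D ^ 405 + 1 := by
      have e1 : t0 D = ell D ^ 519 := rfl
      have e2 : ell1 D = ell D ^ 405 := rfl
      rw [← e1, ← e2]; linarith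
    exact trange13 h80 ht'
  -- `M(s+β₁)/M(s) = E · L(s+β₁)/L(s)`, `‖E‖ ≤ e`
  obtain ⟨E, hE, hYs⟩ := Yroot_shift_eq_mul x (v := b1 c' D) hσ'0 hσ'1 ht8 hb1
  have hY0 : Yroot x.ψ ((σ' : ℂ) + t * I) ≠ 0 := by
    obtain ⟨-, hYsq⟩ := Yroot_spec x.prim
    have him0 : 0 < ((σ' : ℂ) + t * I).im := by simp; linarith
    intro h0
    have := hYsq _ him0
    rw [h0, zero_pow two_ne_zero] at this
    exact inv_ne_zero (Zfac_ne_zero x.prim him0) this.symm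
  have hβ : s + beta1 c' D = (σ' : ℂ) + t * I + (b1 c' D : ℂ) * I := by rw [hβ1, hs_eq]
  have hratio : Mfun x.ψ (s + beta1 c' D) / Mfun x.ψ s =
      E * (x.ψ.LFunction (s + beta1 c' D) / x.ψ.LFunction s) := by
    have h1 : Mfun x.ψ (s + beta1 c' D) = Yroot x.ψ ((σ' : ℂ) + t * I) * E *
        x.ψ.LFunction (s + beta1 c' D) := by
      rw [Mfun, hβ, hYs]
    have h2 : Mfun x.ψ s = Yroot x.ψ ((σ' : ℂ) + t * I) * x.ψ.LFunction s := by
      rw [Mfun, ← hs_eq]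
    rw [h1, h2, mul_assoc, mul_div_mul_left _ _ hY0, mul_div_assoc]
  -- the factor bounds
  have hlogP : Real.log (bigP D) = ell D ^ 9 := by rw [bigP, Real.log_exp]
  have hLq : ‖x.ψ.LFunction (s + beta1 c' D) / x.ψ.LFunction s‖ ≤ (|C₅₉| + 1) * ell D ^ 9 := by
    rw [hlogP] at h59
    exact h59.trans (mul_le_mul_of_nonneg_right (by linarith [le_abs_self C₅₉]) (by positivity))
  have hω : ‖omegaW D s‖ ≤ Real.exp (2 - ell D ^ 10 / 4) :=
    norm_omegaW_le_exp (by linarith) (hσ.trans (by linarith)) ht1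
  have henv := envelope13 (L := ell D) (C := (|C₅₉| + 1) * Hmax) (by linarith) (by positivity)
  rw [hratio]
  calc ‖E * (x.ψ.LFunction (s + beta1 c' D) / x.ψ.LFunction s) * H s * omegaW D s‖
      = ‖E‖ * ‖x.ψ.LFunction (s + beta1 c' D) / x.ψ.LFunction s‖ * ‖H s‖ * ‖omegaW D s‖ := by
        rw [norm_mul, norm_mul, norm_mul]
    _ ≤ Real.exp 1 * ((|C₅₉| + 1) * ell D ^ 9) * Hmax * Real.exp (2 - ell D ^ 10 / 4) := by
        gcongr
    _ = Real.exp 1 * ((|C₅₉| + 1) * Hmax) * ell D ^ 9 * Real.exp (2 - ell D ^ 10 / 4) := by ring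
    _ ≤ Real.exp 3 * ((|C₅₉| + 1) * Hmax) * Real.exp (-(ell D ^ 10 / 8)) := henv
    _ = Real.exp 3 * (|C₅₉| + 1) * Hmax * Real.exp (-(ell D ^ 10 / 8)) := by ring

omit [NeZero D] in
/-- Along a vertical line `σ + iy`, `y > 1`, on which `L(·,ψ)` has no zero, the integrand
`F_H(s) = [M(s+β₁)/M(s)]·H(s)·ω(s)` is continuous in the height `y` (`Y` analytic on `Im s > 0`, `H`
holomorphic there, `L`, `ω` entire, `M(s,ψ) = Y(s)L(s) ≠ 0`). [cite: Zhang2022LandauSiegel, §13 p.75; §8 (8.1) p.42] -/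
theorem continuousOn_convIntegrand_vertical (c' : ℝ) (x : Chr D) (H : ℂ → ℂ)
    (hH : ∀ z : ℂ, 0 < z.im → DifferentiableAt ℂ H z)
    (σ : ℝ) {S : Set ℝ} (hb1 : |b1 c' D| ≤ 1)
    (hS : ∀ y ∈ S, 1 < y) (hL : ∀ y ∈ S, x.ψ.LFunction ((σ : ℂ) + y * I) ≠ 0) :
    ContinuousOn (fun y : ℝ => Mfun x.ψ ((σ : ℂ) + y * I + beta1 c' D) / Mfun x.ψ ((σ : ℂ) + y * I) *
      H ((σ : ℂ) + y * I) * omegaW D ((σ : ℂ) + y * I)) S := by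
  -- adapted from Section8Eq81bEdge.continuousOn_integrandTilde_vertical
  intro y hy
  apply ContinuousAt.continuousWithinAt
  have hy1 := hS y hy
  obtain ⟨hYd, hYsq⟩ := Yroot_spec x.prim
  obtain ⟨hβ1, -, -⟩ := beta_eq_b_mul_I c' D
  have hopen : IsOpen {z : ℂ | 0 < z.im} := isOpen_lt continuous_const Complex.continuous_im
  have hYc : ∀ z : ℂ, 0 < z.im → ContinuousAt (Yroot x.ψ) z := fun z hz =>
    (hYd.differentiableAt (hopen.mem_nhds hz)).continuousAt
  have hLc : Continuous x.ψ.LFunction := Ded81Edge.continuous_LFunction_chr x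
  have hM : ∀ β : ℂ, -1 ≤ β.im →
      ContinuousAt (fun y : ℝ => Mfun x.ψ ((σ : ℂ) + y * I + β)) y := by
    intro β hβ
    have h1 : ContinuousAt (fun y : ℝ => (σ : ℂ) + y * I + β) y := by fun_prop
    have hz : 0 < ((σ : ℂ) + y * I + β).im := by simp; linarith
    have hY1 : ContinuousAt (fun y : ℝ => Yroot x.ψ ((σ : ℂ) + y * I + β)) y :=
      (hYc _ hz).comp_of_eq h1 rfl
    have hL1 : ContinuousAt (fun y : ℝ => x.ψ.LFunction ((σ : ℂ) + y * I + β)) y :=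
      hLc.continuousAt.comp_of_eq h1 rfl
    have h := hY1.mul hL1
    simpa only [Mfun, Pi.mul_def] using h
  have hM0 : ContinuousAt (fun y : ℝ => Mfun x.ψ ((σ : ℂ) + y * I)) y := by
    have h := hM 0 (by simp)
    simpa using h
  have hne : Mfun x.ψ ((σ : ℂ) + y * I) ≠ 0 := by
    have hz : 0 < ((σ : ℂ) + (y : ℂ) * I).im := by simp; linarith
    have hY0 : Yroot x.ψ ((σ : ℂ) + y * I) ≠ 0 := by
      intro h0
      have h2 := hYsq _ hz
      rw [h0, zero_pow two_ne_zero] at h2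
      exact (inv_ne_zero (GammaFactor.Zfac_ne_zero x.prim hz)) h2.symm
    exact mul_ne_zero hY0 (hL y hy)
  have hb1' : -1 ≤ (beta1 c' D).im := by
    rw [hβ1]; simp only [mul_im, ofReal_re, I_im, ofReal_im, I_re]; linarith [abs_le.mp hb1]
  have hC : ContinuousAt (fun y : ℝ => Mfun x.ψ ((σ : ℂ) + y * I + beta1 c' D) /
      Mfun x.ψ ((σ : ℂ) + y * I)) y := (hM _ hb1').div hM0 hne
  have hline : ContinuousAt (fun y : ℝ => (σ : ℂ) + y * I) y := by fun_prop
  have hzy : 0 < ((σ : ℂ) + (y : ℂ) * I).im := by simp; linarith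
  have hHc : ContinuousAt (fun y : ℝ => H ((σ : ℂ) + y * I)) y :=
    (hH _ hzy).continuousAt.comp_of_eq hline rfl
  have hω : Continuous fun y : ℝ => omegaW D ((σ : ℂ) + y * I) :=
    (Ded81Edge.continuous_omega (ell2 D) (t0 D)).comp (by fun_prop : Continuous fun y : ℝ => (σ : ℂ) + y * I)
  have h := (hC.mul hHc).mul hω.continuousAt
  simpa only [Pi.mul_def] using h

end Setting

/-! ## C. The conversion, from Proposition 2.2 -/

/-- `‖1/(2πi)‖ ≤ 1/6` and `‖1/2π‖ ≤ 1/6`. [folklore] -/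
private theorem norm_prefactors_le' :
    ‖(1 / (2 * π * I) : ℂ)‖ ≤ 1 / 6 ∧ ‖(1 / (2 * π) : ℂ)‖ ≤ 1 / 6 := by
  have hπ := Real.pi_gt_three
  have h1 : ‖(1 / (2 * π) : ℂ)‖ = 1 / (2 * π) := by
    rw [show (1 / (2 * π) : ℂ) = ((1 / (2 * π) : ℝ) : ℂ) by push_cast; ring, Complex.norm_real,
      Real.norm_of_nonneg (by positivity)]
  have h2 : ‖(1 / (2 * π * I) : ℂ)‖ = 1 / (2 * π) := by
    rw [norm_div, norm_mul, Complex.norm_I, mul_one, norm_one,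
      show (2 * π : ℂ) = ((2 * π : ℝ) : ℂ) by push_cast; ring, Complex.norm_real,
      Real.norm_of_nonneg (by positivity)]
  have h3 : 1 / (2 * π) ≤ (1 : ℝ) / 6 := by
    rw [div_le_div_iff₀ (by positivity) (by norm_num)]; linarith
  exact ⟨h2 ▸ h3, h1 ▸ h3⟩

/-- A horizontal edge of `∂ℜ` at height `2πt₀ + L′`, `𝓛₁ − 1 ≤ |L′| ≤ 𝓛₁ + ¼`, contributes at most
`M·2α` once the integrand is `≤ M` on the pieces (abstract bookkeeping; `P` = the clearance).
[cite: Zhang2022LandauSiegel, §8 (8.1) p.42] -/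
private theorem norm_integral_horizontal' {F : ℂ → ℂ} {P : ℂ → Prop} {M α T L' ℓ : ℝ}
    (hα : 0 ≤ α)
    (hMs : ∀ s : ℂ, |s.re - 1 / 2| ≤ α → ℓ - 1 ≤ |s.im - T| → |s.im - T| ≤ ℓ + 1 / 4 → P s →
      ‖F s‖ ≤ M)
    (hL'1 : |L'| ≤ ℓ + 1 / 4) (hL'2 : ℓ - 1 ≤ |L'|)
    (hP : ∀ s : ℂ, |s.re - 1 / 2| ≤ α → s.im = T + L' → P s) :
    ‖∫ u in (1 / 2 - α)..(1 / 2 + α), F (u + ((T + L' : ℝ) : ℂ) * I)‖ ≤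
      M * |1 / 2 + α - (1 / 2 - α)| := by
  refine intervalIntegral.norm_integral_le_of_norm_le_const fun u hu => ?_
  rw [Set.uIoc_of_le (by linarith : 1 / 2 - α ≤ 1 / 2 + α)] at hu
  have hre : ((u : ℂ) + ((T + L' : ℝ) : ℂ) * I).re = u := by simp
  have him : ((u : ℂ) + ((T + L' : ℝ) : ℂ) * I).im = T + L' := by simp
  have hσ : |((u : ℂ) + ((T + L' : ℝ) : ℂ) * I).re - 1 / 2| ≤ α := by
    rw [hre, abs_le]; constructor <;> linarith [hu.1, hu.2]
  exact hMs _ hσ (by rw [him, add_sub_cancel_left]; exact hL'2)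
    (by rw [him, add_sub_cancel_left]; exact hL'1) (hP _ hσ him)

/-- A vertical sliver on `σ` (`|σ − ½| = α`) between heights `u`, `v` on the same side of `T = 2πt₀`
with `𝓛₁ − ¼ ≤ |u − T|, |v − T| ≤ 𝓛₁ + ¼` contributes at most `M·|v − u|` (abstract bookkeeping).
[cite: Zhang2022LandauSiegel, §8 (8.1) p.42] -/
private theorem norm_integral_vertical' {F : ℂ → ℂ} {P : ℂ → Prop} {M α T ℓ σ u v : ℝ}
    (hMs : ∀ s : ℂ, |s.re - 1 / 2| ≤ α → ℓ - 1 ≤ |s.im - T| → |s.im - T| ≤ ℓ + 1 / 4 → P s →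
      ‖F s‖ ≤ M)
    (hσ : |σ - 1 / 2| = α)
    (hu1 : ℓ - 1 / 4 ≤ |u - T|) (hu2 : |u - T| ≤ ℓ + 1 / 4)
    (hv1 : ℓ - 1 / 4 ≤ |v - T|) (hv2 : |v - T| ≤ ℓ + 1 / 4)
    (hside : (0 ≤ u - T ∧ 0 ≤ v - T) ∨ (u - T ≤ 0 ∧ v - T ≤ 0))
    (hP : ∀ s : ℂ, |s.re - 1 / 2| = α → |s.im - T| ≤ ℓ + 1 → P s) :
    ‖∫ y in u..v, F ((σ : ℂ) + y * I)‖ ≤ M * |v - u| := by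
  refine intervalIntegral.norm_integral_le_of_norm_le_const fun y hy => ?_
  have hre : ((σ : ℂ) + y * I).re = σ := by simp
  have him : ((σ : ℂ) + y * I).im = y := by simp
  have hy' : ℓ - 1 / 4 ≤ |y - T| ∧ |y - T| ≤ ℓ + 1 / 4 := by
    rw [Set.mem_uIoc] at hy
    rcases hside with ⟨hu0, hv0⟩ | ⟨hu0, hv0⟩
    · rw [abs_of_nonneg hu0] at hu1 hu2
      rw [abs_of_nonneg hv0] at hv1 hv2
      rcases hy with ⟨hy1, hy2⟩ | ⟨hy1, hy2⟩
      · rw [abs_of_nonneg (by linarith)]; constructor <;> linarith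
      · rw [abs_of_nonneg (by linarith)]; constructor <;> linarith
    · rw [abs_of_nonpos hu0] at hu1 hu2
      rw [abs_of_nonpos hv0] at hv1 hv2
      rcases hy with ⟨hy1, hy2⟩ | ⟨hy1, hy2⟩
      · rw [abs_of_nonpos (by linarith)]; constructor <;> linarith
      · rw [abs_of_nonpos (by linarith)]; constructor <;> linarith
  exact hMs _ (by rw [hre, hσ]) (by rw [him]; linarith [hy'.1]) (by rw [him]; exact hy'.2)
    (hP _ (by rw [hre, hσ]) (by rw [him]; linarith [hy'.2]))

/-- The final arithmetic: six pieces of size `≤ M/4` each, weighted by `‖1/2πi‖, ‖1/2π‖ ≤ 1/6`,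
total at most `M`. [folklore] -/
private theorem six_pieces_le' {k m Hc Hd Pb Qb Pa Qa : ℂ} {M l₁ l₂ l₃ : ℝ} (hM : 0 ≤ M)
    (hk : ‖k‖ ≤ 1 / 6) (hm : ‖m‖ ≤ 1 / 6)
    (hHc : ‖Hc‖ ≤ M * l₁) (hHd : ‖Hd‖ ≤ M * l₁) (hPb : ‖Pb‖ ≤ M * l₂) (hQb : ‖Qb‖ ≤ M * l₃)
    (hPa : ‖Pa‖ ≤ M * l₂) (hQa : ‖Qa‖ ≤ M * l₃)
    (hl₁ : l₁ ≤ 1 / 4) (hl₂ : l₂ ≤ 1 / 4) (hl₃ : l₃ ≤ 1 / 4) :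
    ‖k * (Hc - Hd) + m * (Pb - Qb) - m * (Pa - Qa)‖ ≤ M := by
  have h1 : ‖k * (Hc - Hd)‖ ≤ 1 / 6 * (M / 4 + M / 4) := by
    rw [norm_mul]
    exact mul_le_mul hk ((norm_sub_le _ _).trans (add_le_add (by nlinarith) (by nlinarith)))
      (norm_nonneg _) (by norm_num)
  have h2 : ‖m * (Pb - Qb)‖ ≤ 1 / 6 * (M / 4 + M / 4) := by
    rw [norm_mul]
    exact mul_le_mul hm ((norm_sub_le _ _).trans (add_le_add (by nlinarith) (by nlinarith)))
      (norm_nonneg _) (by norm_num)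
  have h3 : ‖m * (Pa - Qa)‖ ≤ 1 / 6 * (M / 4 + M / 4) := by
    rw [norm_mul]
    exact mul_le_mul hm ((norm_sub_le _ _).trans (add_le_add (by nlinarith) (by nlinarith)))
      (norm_nonneg _) (by norm_num)
  calc ‖k * (Hc - Hd) + m * (Pb - Qb) - m * (Pa - Qa)‖
      ≤ ‖k * (Hc - Hd) + m * (Pb - Qb)‖ + ‖m * (Pa - Qa)‖ := norm_sub_le _ _
    _ ≤ ‖k * (Hc - Hd)‖ + ‖m * (Pb - Qb)‖ + ‖m * (Pa - Qa)‖ :=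
        add_le_add (norm_add_le _ _) le_rfl
    _ ≤ 1 / 6 * (M / 4 + M / 4) + 1 / 6 * (M / 4 + M / 4) + 1 / 6 * (M / 4 + M / 4) := by
        linarith
    _ ≤ M := by linarith

set_option maxHeartbeats 400000 in
/-- **The (2.34)/residue conversion for a generic holomorphic co-factor, from Proposition 2.2**
(§13 p.75: "by (2.34), `ΣΣ|L(ρ+β₁)/L′(ρ)|·[…](ρ)·ω(ρ) = −(1/2π)Σ_ψ(∫_{𝒥(α)} − ∫_{𝒥(−α)})[M(s+β₁)/M(s)]·[…]·ω ds
+ O(ε)`", made explicit for ANY co-factor): for `c′ ≥ 0` with `Skeleton.Prop22 c′` there is `K ≥ 0`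
such that for all large `D` (beyond Proposition 2.2's threshold and `𝓛 ≥ max(80, 5πc′+1)`), every
`ψ ∈ Ψ₁`, every `H` holomorphic on the upper half-plane and every `H_max ≥ 0` with `‖H(s)‖ ≤ H_max` on
`|σ − ½| ≤ α`, `|t − 2πt₀| ≤ 𝓛₁ + 1`:
`‖Σ_{ρ∈𝔷(ψ)} [M(ρ+β₁,ψ)/M′(ρ,ψ)]·H(ρ)·ω(ρ) − (segInt_α F_H − segInt_{−α} F_H)‖ ≤ K·H_max·e^{−𝓛¹⁰/8}`,
`F_H(s) = [M(s+β₁,ψ)/M(s,ψ)]·H(s)·ω(s)`. Proof = the §8 proof of (8.1) for this integrand: admissible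
rectangle (`admRect_of_prop22_at`), residue theorem (`zeroSum_eq_rectIntegral_at`), contour bookkeeping
(`rectIntegral_sub_segInt_eq`), the pointwise bound `norm_convIntegrand_le` on the six pieces (Lemma 5.9
on `|t − 2πt₀| ≤ 𝓛₁ + ¼` from Prop. 2.2, `lemma59_restricted_of_prop22`; clearance on `∂ℜ` by
admissibility and on `σ = ½ ± α` by Prop. 2.2 (i), `clearance_of_prop22i`). `K = e³(|C₅.₉|+1)`.
[cite: Zhang2022LandauSiegel, §13 p.75, tex L3810–L3817; §8 (8.1) p.42] -/
theorem zeroSum_conversion_of_prop22 {c' : ℝ} (hc' : 0 ≤ c') (h22 : Prop22 c') :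
    ∃ K : ℝ, 0 ≤ K ∧ ForAllLarge fun D _ χ => ∀ x ∈ PsiOne χ, ∀ (H : ℂ → ℂ) (Hmax : ℝ),
      0 ≤ Hmax → (∀ z : ℂ, 0 < z.im → DifferentiableAt ℂ H z) →
      (∀ s : ℂ, |s.re - 1 / 2| ≤ alpha D → |s.im - 2 * π * t0 D| ≤ ell1 D + 1 → ‖H s‖ ≤ Hmax) →
      ‖(∑ ρ ∈ finsetOf (zeroSet D x),
            Mfun x.ψ (ρ + beta1 c' D) / deriv (Mfun x.ψ) ρ * H ρ * omegaW D ρ) -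
          (Lemma81.segInt (t0 D) (ell1 D) ((alpha D : ℝ) : ℂ)
              (fun s => Mfun x.ψ (s + beta1 c' D) / Mfun x.ψ s * H s * omegaW D s) -
            Lemma81.segInt (t0 D) (ell1 D) ((-alpha D : ℝ) : ℂ)
              (fun s => Mfun x.ψ (s + beta1 c' D) / Mfun x.ψ s * H s * omegaW D s))‖ ≤
        K * Hmax * Real.exp (-(ell D ^ 10 / 8)) := by
  -- adapted from Section8Eq81bEdge.eq81b_of_prop22 + Section8Eq81aResidue.eq81a_of_prop22
  obtain ⟨C₅₉, D₅₉, h59⟩ := lemma59_restricted_of_prop22 hc' h22 (1 / 8) (by norm_num)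
  obtain ⟨h_i, h_ii, h_iii⟩ := h22
  obtain ⟨D₂₂, h22all⟩ := (h_i.and h_ii).and h_iii
  set K : ℝ := Real.exp 3 * (|C₅₉| + 1) with hK
  set L₀ : ℝ := max 80 (5 * π * |c'| + 1) with hL₀
  refine ⟨K, by positivity, max (max D₅₉ 3) (max D₂₂ ⌈Real.exp L₀⌉₊), ?_⟩
  intro D _ χ hD hq hp x hx H Hmax hHmax hH hHb
  -- thresholds
  have hD59 : D₅₉ ≤ D := (le_max_left _ _).trans ((le_max_left _ _).trans hD)
  have hD3 : 3 ≤ D := (le_max_right _ _).trans ((le_max_left _ _).trans hD)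
  have hD22 : D₂₂ ≤ D := (le_max_left _ _).trans ((le_max_right _ _).trans hD)
  have hDℓ : ⌈Real.exp L₀⌉₊ ≤ D := (le_max_right _ _).trans ((le_max_right _ _).trans hD)
  have hL : L₀ ≤ ell D := threshold_le_ell hDℓ
  have h80 : 80 ≤ ell D := (le_max_left _ _).trans hL
  have hcL : 5 * π * |c'| + 1 ≤ ell D := (le_max_right _ _).trans hL
  obtain ⟨hα0, -, hα100, hsmall, hb1, hb1nn⟩ := params13 hc' h80 hcL
  have hα4 : alpha D ≤ 1 / 4 := by linarith
  have hα8 : alpha D ≤ 1 / 8 := by linarith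
  have hK0 : 0 ≤ K := by rw [hK]; positivity
  have hℓ1 : (1 : ℝ) ≤ ell1 D := by rw [ell1]; exact one_le_pow₀ (by linarith)
  obtain ⟨⟨e_i, e_ii⟩, e_iii⟩ := h22all D χ hD22 hq hp
  have hβ1im : 0 ≤ (beta1 c' D).im := by
    obtain ⟨hβ1, -, -⟩ := beta_eq_b_mul_I c' D
    rw [hβ1]; simp only [mul_im, ofReal_re, I_im, ofReal_im, I_re]; linarith
  -- the admissible rectangle (`C = 1`, `c₀ = 1/8`)
  obtain ⟨Lm, Lp, hR⟩ := admRect_of_prop22_at χ hD3 hp hc' hsmall hα8 x (e_i x hx) (e_iii x hx)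
  obtain ⟨hLp, hLm, hzeros, hclear⟩ := hR
  have hCα' : (1 : ℝ) * alpha D ≤ 1 / 4 := by linarith
  obtain ⟨hLp1, hLp2⟩ := abs_le.mp (hLp.trans hCα')
  obtain ⟨hLm1, hLm2⟩ := abs_le.mp (hLm.trans hCα')
  have hLmLp : Lm < Lp := by linarith
  have hLmpos : 1 / 8 * alpha D < 2 * π * t0 D + Lm := by
    have ht0 : ell1 D ≤ t0 D := pow_le_pow_right₀ (by linarith : (1 : ℝ) ≤ ell D) (by norm_num)
    nlinarith [Real.pi_gt_three]
  -- (0) the residue theorem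
  have hA := zeroSum_eq_rectIntegral_at χ hD3 hp c' x H hH hβ1im (by norm_num : (0 : ℝ) < 1 / 8)
    hα0 hLmpos hLmLp (fun s hs => e_ii x hx s hs) ⟨hLp, hLm, hzeros, hclear⟩
  rw [hA]
  -- the integrand
  set F : ℂ → ℂ := fun s => Mfun x.ψ (s + beta1 c' D) / Mfun x.ψ s * H s * omegaW D s with hF
  -- (1) the pointwise bound `M` on the pieces, with the clearance predicate `P`
  have hMs : ∀ s : ℂ, |s.re - 1 / 2| ≤ alpha D → ell1 D - 1 ≤ |s.im - 2 * π * t0 D| →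
      |s.im - 2 * π * t0 D| ≤ ell1 D + 1 / 4 →
      (∀ ρ : ℂ, x.ψ.LFunction ρ = 0 → 1 / 8 * alpha D ≤ ‖s - ρ‖) →
      ‖F s‖ ≤ K * Hmax * Real.exp (-(ell D ^ 10 / 8)) := by
    intro s hσ ht1 ht2 hcl
    have h59s := h59 D χ hD59 hq hp x hx s hσ ht2 hcl
    have hHs := hHb s hσ (by linarith)
    have h := norm_convIntegrand_le c' x H hc' h80 hcL hHmax hσ ht1 ht2 h59s hHs
    rw [hK]; exact h
  -- (2) the clearance: on `∂ℜ` by admissibility, on `σ = ½ ± α` by Prop. 2.2 (i)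
  have h22x : ∀ s ∈ prodZeroSetOmega χ x, s.re = 1 / 2 := e_i x hx
  have hclV : ∀ s : ℂ, |s.re - 1 / 2| = alpha D → |s.im - 2 * π * t0 D| ≤ ell1 D + 1 →
      ∀ ρ : ℂ, x.ψ.LFunction ρ = 0 → 1 / 8 * alpha D ≤ ‖s - ρ‖ := by
    intro s hσ ht ρ hρ
    have h := clearance_of_prop22i h22x hα4 hσ ht ρ hρ
    linarith
  have hclH : ∀ L' : ℝ, (L' = Lm ∨ L' = Lp) → ∀ s : ℂ, |s.re - 1 / 2| ≤ alpha D →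
      s.im = 2 * π * t0 D + L' →
      ∀ ρ : ℂ, x.ψ.LFunction ρ = 0 → 1 / 8 * alpha D ≤ ‖s - ρ‖ := by
    intro L' hL' s hs1 hs2 ρ hρ
    have hon : s ∈ onBoundaryR D Lm Lp := by
      refine ⟨⟨hs1, ?_, ?_⟩, ?_⟩
      · rcases hL' with rfl | rfl <;> linarith
      · rcases hL' with rfl | rfl <;> linarith
      · intro hin
        rcases hL' with rfl | rfl
        · exact absurd hin.2.1 (by rw [hs2]; exact lt_irrefl _)
        · exact absurd hin.2.2 (by rw [hs2]; exact lt_irrefl _)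
    exact hclear s hon ρ hρ
  -- (3) continuity along `σ = ½ ± α` on `[T − 𝓛₁ − ¼, T + 𝓛₁ + ¼]` (no zero there, by (2))
  have hcontV : ∀ σ : ℝ, |σ - 1 / 2| = alpha D →
      ContinuousOn (fun y : ℝ => F ((σ : ℂ) + y * I))
        (Icc (2 * π * t0 D - ell1 D - 1 / 4) (2 * π * t0 D + ell1 D + 1 / 4)) := by
    intro σ hσ
    have h := continuousOn_convIntegrand_vertical c' x H hH σ hb1
      (S := Icc (2 * π * t0 D - ell1 D - 1 / 4) (2 * π * t0 D + ell1 D + 1 / 4))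
      (fun y hy => ?_) (fun y hy => ?_)
    · simpa only [hF] using h
    · have hy' : |y - 2 * π * ell D ^ 519| ≤ ell D ^ 405 + 1 := by
        have e1 : t0 D = ell D ^ 519 := rfl
        have e2 : ell1 D = ell D ^ 405 := rfl
        rw [← e1, ← e2, abs_le]; constructor <;> linarith [hy.1, hy.2]
      linarith [trange13 h80 hy']
    · intro h0
      have hy' : |((σ : ℂ) + y * I).im - 2 * π * t0 D| ≤ ell1 D + 1 := by
        have : ((σ : ℂ) + y * I).im = y := by simp
        rw [this, abs_le]; constructor <;> linarith [hy.1, hy.2]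
      have h := hclV ((σ : ℂ) + y * I) (by simpa using hσ) hy' _ h0
      rw [sub_self, norm_zero] at h
      linarith [mul_pos (by norm_num : (0 : ℝ) < 1 / 8) hα0]
  have hσb : |1 / 2 + alpha D - 1 / 2| = alpha D := by rw [add_sub_cancel_left, abs_of_pos hα0]
  have hσa : |1 / 2 - alpha D - 1 / 2| = alpha D := by
    rw [sub_sub_cancel_left, abs_neg, abs_of_pos hα0]
  -- (4) the contour identity
  have hE := rectIntegral_sub_segInt_eq F Lm Lp _ _
    (hcontV _ hσb) (hcontV _ hσa) (by constructor <;> linarith) (by constructor <;> linarith)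
    (by constructor <;> linarith) (by constructor <;> linarith)
  rw [hE]
  -- (5) the six pieces
  have hT1 : ∀ u : ℝ, 2 * π * t0 D + u - 2 * π * t0 D = u := fun u => by ring
  have hT2 : 2 * π * t0 D - ell1 D - 2 * π * t0 D = -ell1 D := by ring
  have hLmA : |Lm| ≤ ell1 D + 1 / 4 ∧ ell1 D - 1 / 4 ≤ |Lm| := by
    rw [abs_of_nonpos (by linarith)]; constructor <;> linarith
  have hLpA : |Lp| ≤ ell1 D + 1 / 4 ∧ ell1 D - 1 / 4 ≤ |Lp| := by
    rw [abs_of_nonneg (by linarith)]; constructor <;> linarith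
  have hℓA : |ell1 D| = ell1 D := abs_of_nonneg (by linarith)
  have hℓA' : |(-ell1 D)| = ell1 D := by rw [abs_neg, hℓA]
  have hq1 : ell1 D - 1 / 4 ≤ ell1 D := by linarith
  have hq2 : ell1 D ≤ ell1 D + 1 / 4 := by linarith
  have hHc := norm_integral_horizontal' (L' := Lm) hα0.le hMs hLmA.1 (by linarith [hLmA.2])
    (hclH Lm (Or.inl rfl))
  have hHd := norm_integral_horizontal' (L' := Lp) hα0.le hMs hLpA.1 (by linarith [hLpA.2])
    (hclH Lp (Or.inr rfl))
  have hPb := norm_integral_vertical' (u := 2 * π * t0 D + Lm) (v := 2 * π * t0 D - ell1 D)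
    hMs hσb (by rw [hT1]; exact hLmA.2) (by rw [hT1]; exact hLmA.1) (by rw [hT2, hℓA']; exact hq1)
    (by rw [hT2, hℓA']; exact hq2) (Or.inr ⟨by rw [hT1]; linarith, by rw [hT2]; linarith⟩) hclV
  have hQb := norm_integral_vertical' (u := 2 * π * t0 D + Lp) (v := 2 * π * t0 D + ell1 D)
    hMs hσb (by rw [hT1]; exact hLpA.2) (by rw [hT1]; exact hLpA.1) (by rw [hT1, hℓA]; exact hq1)
    (by rw [hT1, hℓA]; exact hq2) (Or.inl ⟨by rw [hT1]; linarith, by rw [hT1]; linarith⟩) hclV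
  have hPa := norm_integral_vertical' (u := 2 * π * t0 D + Lm) (v := 2 * π * t0 D - ell1 D)
    hMs hσa (by rw [hT1]; exact hLmA.2) (by rw [hT1]; exact hLmA.1) (by rw [hT2, hℓA']; exact hq1)
    (by rw [hT2, hℓA']; exact hq2) (Or.inr ⟨by rw [hT1]; linarith, by rw [hT2]; linarith⟩) hclV
  have hQa := norm_integral_vertical' (u := 2 * π * t0 D + Lp) (v := 2 * π * t0 D + ell1 D)
    hMs hσa (by rw [hT1]; exact hLpA.2) (by rw [hT1]; exact hLpA.1) (by rw [hT1, hℓA]; exact hq1)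
    (by rw [hT1, hℓA]; exact hq2) (Or.inl ⟨by rw [hT1]; linarith, by rw [hT1]; linarith⟩) hclV
  -- lengths and prefactors
  have hlenH : |1 / 2 + alpha D - (1 / 2 - alpha D)| ≤ 1 / 4 := by
    rw [show 1 / 2 + alpha D - (1 / 2 - alpha D) = 2 * alpha D by ring, abs_of_pos (by positivity)]
    linarith
  have hlen1 : |2 * π * t0 D - ell1 D - (2 * π * t0 D + Lm)| ≤ 1 / 4 := by
    rw [show 2 * π * t0 D - ell1 D - (2 * π * t0 D + Lm) = -(Lm + ell1 D) by ring, abs_neg]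
    exact hLm.trans hCα'
  have hlen2 : |2 * π * t0 D + ell1 D - (2 * π * t0 D + Lp)| ≤ 1 / 4 := by
    rw [show 2 * π * t0 D + ell1 D - (2 * π * t0 D + Lp) = -(Lp - ell1 D) by ring, abs_neg]
    exact hLp.trans hCα'
  obtain ⟨hk, hm⟩ := norm_prefactors_le'
  -- (6) assemble
  exact six_pieces_le' (mul_nonneg (mul_nonneg hK0 hHmax) (Real.exp_pos _).le) hk hm hHc hHd hPb
    hQb hPa hQa hlenH hlen1 hlen2

/-- **The conversion with the positive weight of (2.34)** — `|L(ρ+β₁,ψ)/L′(ρ,ψ)| = −iM(ρ+β₁,ψ)/M′(ρ,ψ)`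
for `ψ ∈ Ψ₁`, `ρ ∈ 𝔷(ψ)` (tree theorem `Section2.eq234_of_prop22`): for `c′ ≥ 0` with
`Skeleton.Prop22 c′`, with the same `K`, for all large `D`, every `ψ ∈ Ψ₁` and every admissible `H`,
`‖Σ_{ρ∈𝔷(ψ)} |L(ρ+β₁,ψ)/L′(ρ,ψ)|·H(ρ)·ω(ρ) + i(segInt_α F_H − segInt_{−α} F_H)‖ ≤ K·H_max·e^{−𝓛¹⁰/8}`
— i.e. "`ΣΣ|L(ρ+β₁)/L′(ρ)|[…]ω(ρ) = −(1/2π)Σ(∫_{𝒥(α)} − ∫_{𝒥(−α)})[M(s+β₁)/M(s)][…]ω ds + O(ε)`" of p. 75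
(`−(1/2π)∫_{𝒥(z)} = −i·segInt_z`), for one `ψ` and a generic co-factor.
[cite: Zhang2022LandauSiegel, §13 p.75, tex L3810–L3817; §2 (2.34) p.12] -/
theorem zeroSum_conversion_eq234_of_prop22 {c' : ℝ} (hc' : 0 ≤ c') (h22 : Prop22 c') :
    ∃ K : ℝ, 0 ≤ K ∧ ForAllLarge fun D _ χ => ∀ x ∈ PsiOne χ, ∀ (H : ℂ → ℂ) (Hmax : ℝ),
      0 ≤ Hmax → (∀ z : ℂ, 0 < z.im → DifferentiableAt ℂ H z) →
      (∀ s : ℂ, |s.re - 1 / 2| ≤ alpha D → |s.im - 2 * π * t0 D| ≤ ell1 D + 1 → ‖H s‖ ≤ Hmax) →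
      ‖(∑ ρ ∈ finsetOf (zeroSet D x),
            ((‖x.ψ.LFunction (ρ + beta1 c' D) / deriv x.ψ.LFunction ρ‖ : ℝ) : ℂ) * H ρ * omegaW D ρ) +
          I * (Lemma81.segInt (t0 D) (ell1 D) ((alpha D : ℝ) : ℂ)
              (fun s => Mfun x.ψ (s + beta1 c' D) / Mfun x.ψ s * H s * omegaW D s) -
            Lemma81.segInt (t0 D) (ell1 D) ((-alpha D : ℝ) : ℂ)
              (fun s => Mfun x.ψ (s + beta1 c' D) / Mfun x.ψ s * H s * omegaW D s))‖ ≤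
        K * Hmax * Real.exp (-(ell D ^ 10 / 8)) := by
  obtain ⟨K, hK0, D₁, hconv⟩ := zeroSum_conversion_of_prop22 hc' h22
  obtain ⟨D₂, h234⟩ := Section2.eq234_of_prop22 hc' h22
  refine ⟨K, hK0, max D₁ D₂, fun D _ χ hD hq hp x hx H Hmax hHmax hH hHb => ?_⟩
  have hD₁ : D₁ ≤ D := (le_max_left _ _).trans hD
  have hD₂ : D₂ ≤ D := (le_max_right _ _).trans hD
  have h := hconv D χ hD₁ hq hp x hx H Hmax hHmax hH hHb
  have h234x := h234 D χ hD₂ hq hp x hx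
  have hfin : (zeroSet D x).Finite := zerosFinite_holds D x
  -- rewrite the weights by (2.34)
  have hsum : (∑ ρ ∈ finsetOf (zeroSet D x),
      ((‖x.ψ.LFunction (ρ + beta1 c' D) / deriv x.ψ.LFunction ρ‖ : ℝ) : ℂ) * H ρ * omegaW D ρ) =
      -I * ∑ ρ ∈ finsetOf (zeroSet D x),
        Mfun x.ψ (ρ + beta1 c' D) / deriv (Mfun x.ψ) ρ * H ρ * omegaW D ρ := by
    rw [Finset.mul_sum]
    refine Finset.sum_congr rfl fun ρ hρ => ?_
    rw [h234x ρ ((mem_finsetOf hfin).mp hρ)]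
    ring
  rw [hsum]
  set Ssum := ∑ ρ ∈ finsetOf (zeroSet D x),
    Mfun x.ψ (ρ + beta1 c' D) / deriv (Mfun x.ψ) ρ * H ρ * omegaW D ρ
  set J := Lemma81.segInt (t0 D) (ell1 D) ((alpha D : ℝ) : ℂ)
      (fun s => Mfun x.ψ (s + beta1 c' D) / Mfun x.ψ s * H s * omegaW D s) -
    Lemma81.segInt (t0 D) (ell1 D) ((-alpha D : ℝ) : ℂ)
      (fun s => Mfun x.ψ (s + beta1 c' D) / Mfun x.ψ s * H s * omegaW D s)
  have hrw : -I * Ssum + I * J = -I * (Ssum - J) := by ring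
  rw [hrw, norm_mul, norm_neg, Complex.norm_I, one_mul]
  exact h

/-- **The conversion for every sufficiently large `c′`, NO hypothesis** (Proposition 2.2 is a tree
theorem for large `c′`: `Skeleton.prop22_eventually`): there is `c₀ ≥ 0` such that for every
`c′ ≥ c₀` the conclusion of `zeroSum_conversion_eq234_of_prop22` holds.
[cite: Zhang2022LandauSiegel, §13 p.75, tex L3810–L3817; §2 (2.34), Prop. 2.2] -/
theorem zeroSum_conversion_eventually : ∃ c₀ : ℝ, 0 ≤ c₀ ∧ ∀ c' : ℝ, c₀ ≤ c' →
    ∃ K : ℝ, 0 ≤ K ∧ ForAllLarge fun D _ χ => ∀ x ∈ PsiOne χ, ∀ (H : ℂ → ℂ) (Hmax : ℝ),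
      0 ≤ Hmax → (∀ z : ℂ, 0 < z.im → DifferentiableAt ℂ H z) →
      (∀ s : ℂ, |s.re - 1 / 2| ≤ alpha D → |s.im - 2 * π * t0 D| ≤ ell1 D + 1 → ‖H s‖ ≤ Hmax) →
      ‖(∑ ρ ∈ finsetOf (zeroSet D x),
            ((‖x.ψ.LFunction (ρ + beta1 c' D) / deriv x.ψ.LFunction ρ‖ : ℝ) : ℂ) * H ρ * omegaW D ρ) +
          I * (Lemma81.segInt (t0 D) (ell1 D) ((alpha D : ℝ) : ℂ)
              (fun s => Mfun x.ψ (s + beta1 c' D) / Mfun x.ψ s * H s * omegaW D s) -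
            Lemma81.segInt (t0 D) (ell1 D) ((-alpha D : ℝ) : ℂ)
              (fun s => Mfun x.ψ (s + beta1 c' D) / Mfun x.ψ s * H s * omegaW D s))‖ ≤
        K * Hmax * Real.exp (-(ell D ^ 10 / 8)) := by
  obtain ⟨c₀, hc₀, h⟩ := prop22_eventually
  exact ⟨c₀, hc₀, fun c' hc' => zeroSum_conversion_eq234_of_prop22 (hc₀.trans hc') (h c' hc')⟩

end Literature.NumberTheory.LFunctions.Zhang2022.Typed.Section13

end
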